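import Literature.AlgebraicGeometry.Morphisms.CechH1FlatBaseChange
import HarnessLib

/-!
# Base change of sections and of Čech cochains along ANY `Spec B → Spec A`, for AFFINE opens

Topic `AlgebraicGeometry/Morphisms`; namespace `Literature.AlgebraicGeometry.Morphisms`; a *proofs* file
(theorems only). For a cartesian square of schemes over affine bases
```
      Z ──g──▶ X
   f_Z│        │f_X
      ▼        ▼
   Spec B ──▶ Spec A
```
★ `Morphisms/SectionsFlatBaseChange` constructs the base-change maps `bcSections : B ⊗_A Γ(X, V) → Γ(Z, g⁻¹V)`,
`bcPi`, and ★ `Morphisms/CechH1FlatBaseChange` the cochain maps `bcC0`, `bcC1` (commuting with `d⁰`: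
`bcC1_lTensor_cechD0`), and proves them bijective for `A → B` FLAT and `V` quasi-compact quasi-separated.
Here: for `V` AFFINE they are bijective for EVERY `A`-algebra `B` — `g⁻¹V = Spec (Γ(X, V) ⊗_A B)`
(Görtz–Wedhorn I, Prop. 4.20; Stacks 01JO; Mathlib `isIso_pushoutSection_of_isAffineOpen`):

* `bcSections_bijective_of_isAffineOpen`, `bcPi_bijective_of_isAffineOpen` (same transport as the flat
  versions, with Mathlib's affine pushout statement in place of the flat one);
* `bcC0_bijective_of_isAffineOpen`, `bcC1_bijective_of_isAffineOpen` — for a finite family of affine opens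
  `U_i` with affine pairwise intersections (e.g. any affine opens of a separated `X`),
  `B ⊗_A Čᵖ(𝒰, 𝒪_X) → Čᵖ(g⁻¹𝒰, 𝒪_Z)` is bijective for `p = 0, 1` and every `B`.

This is the «Čech complex of the base change» identification used for cohomology and base change over
ARBITRARY (e.g. Artinian, non-flat) bases (cell `hodgecm-mathlib`, brick (u7) «universal Stein», piece (u7-ii);
consumer ★ `AbelianSchemes/AbelianSchemeSteinOfArtinian`). Everything is proved; no named facts; no
definitions. Mathlib searched and used (pin): `isIso_pushoutSection_of_isAffineOpen`, `isIso_pushoutSection_iff`,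
`CommRingCat.isPushout_iff_isPushout`, `Algebra.IsPushout.equiv_tmul`, `Scheme.ΓSpecIso_naturality`.

## References

* U. Görtz, T. Wedhorn, *Algebraic Geometry I: Schemes*, 2nd ed. (2020), Prop. 4.20, Thm. 4.18. [GortzWedhorn2020]
* The Stacks Project, Tag 01JO (Schemes, Lemma 26.17.x: fibre products of affines); Tag 02KH. [StacksProject]
-/

noncomputable section

open CategoryTheory AlgebraicGeometry Limits TopologicalSpace Opposite TensorProduct

universe u v

namespace Literature.AlgebraicGeometry.Morphisms

variable {A B : Type u} [CommRing A] [CommRing B] [Algebra A B] {X Z : Scheme.{u}}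
  (fX : X ⟶ Spec (.of A)) (fZ : Z ⟶ Spec (.of B)) (g : Z ⟶ X)

/-! ## One affine open -/

section One

/-- **Affine base change of `H⁰`**: for the cartesian square `Z = X ×_{Spec A} Spec B` with `B` ANY
`A`-algebra and `V ⊆ X` an AFFINE open, `B ⊗_A Γ(X, V) → Γ(Z, g⁻¹V)`, `b ⊗ s ↦ f_Z^*(b) · g^*(s)`
(★ `bcSections`), is bijective: Mathlib's `isIso_pushoutSection_of_isAffineOpen` transported along
`Γ(Spec A) ≅ A`, `Γ(Spec B) ≅ B` and compared with `Algebra.IsPushout.equiv` on pure tensors (the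
transport of ★ `bcSections_bijective`). [cite: GortzWedhorn2020, Prop. 4.20] [cite: StacksProject, Tag 01JO] -/
theorem bcSections_bijective_of_isAffineOpen
    (H : IsPullback g fZ fX (Spec.map (CommRingCat.ofHom (algebraMap A B)))) {V : X.Opens}
    (hV : IsAffineOpen V) :
    Function.Bijective (bcSections fX fZ g H.w (le_refl (g ⁻¹ᵁ V))) := by
  -- `Γ(Z, g⁻¹V)` (with its `A`-structure) as a `B`-algebra, compatibly (`toSectionsBase` is `A`-linear)
  letI : Algebra B (Sections (restrictBase A fZ) (g ⁻¹ᵁ V)) :=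
    inferInstanceAs (Algebra B (Sections fZ (g ⁻¹ᵁ V)))
  haveI : IsScalarTower A B (Sections (restrictBase A fZ) (g ⁻¹ᵁ V)) :=
    IsScalarTower.of_algebraMap_eq fun a => ((toSectionsBase A fZ (g ⁻¹ᵁ V)).commutes a).symm
  -- ... and as a `Γ(X, V)`-algebra through `g^*`, compatibly with the `A`-structures
  letI : Algebra (Sections fX V) (Sections (restrictBase A fZ) (g ⁻¹ᵁ V)) :=
    (Sections.comap fX (restrictBase A fZ) g H.w (le_refl (g ⁻¹ᵁ V))).toRingHom.toAlgebra
  haveI : IsScalarTower A (Sections fX V) (Sections (restrictBase A fZ) (g ⁻¹ᵁ V)) :=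
    IsScalarTower.of_algebraMap_eq fun a =>
      ((Sections.comap fX (restrictBase A fZ) g H.w (le_refl (g ⁻¹ᵁ V))).commutes a).symm
  -- Mathlib's cartesian-square statement for affine corners, `U_S = ⊤`, `U_T = ⊤`, `U_X = V`, `U_Y = g⁻¹V`
  have hsq := (isIso_pushoutSection_iff H (US := ⊤) (UT := ⊤) (UX := V) le_top le_top
      (UY := g ⁻¹ᵁ V) (by simp)).mp
    (isIso_pushoutSection_of_isAffineOpen H le_top le_top (by simp)
      (isAffineOpen_top _) (isAffineOpen_top _) hV)
  have hsq' : IsPushout (CommRingCat.ofHom (algebraMap A (Sections fX V)))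
      (CommRingCat.ofHom (algebraMap A B))
      (CommRingCat.ofHom (algebraMap (Sections fX V) (Sections (restrictBase A fZ) (g ⁻¹ᵁ V))))
      (CommRingCat.ofHom (algebraMap B (Sections (restrictBase A fZ) (g ⁻¹ᵁ V)))) := by
    refine hsq.of_iso (Scheme.ΓSpecIso (.of A)) (Iso.refl _) (Scheme.ΓSpecIso (.of B))
      (Iso.refl _) ?_ ?_ ?_ ?_
    · simp only [Iso.refl_hom]; rw [← Iso.inv_comp_eq]; rfl
    · have happ : (Spec.map (CommRingCat.ofHom (algebraMap A B))).appLE ⊤ ⊤ le_top =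
          (Spec.map (CommRingCat.ofHom (algebraMap A B))).appTop := rfl
      rw [happ]; exact Scheme.ΓSpecIso_naturality _
    · simp only [Iso.refl_hom]; rfl
    · simp only [Iso.refl_hom]; rw [← Iso.inv_comp_eq]; rfl
  haveI hP : Algebra.IsPushout A B (Sections fX V) (Sections (restrictBase A fZ) (g ⁻¹ᵁ V)) :=
    CommRingCat.isPushout_iff_isPushout.mp hsq'.flip
  let e := Algebra.IsPushout.equiv A B (Sections fX V) (Sections (restrictBase A fZ) (g ⁻¹ᵁ V))
  have he : ∀ t, e t = bcSections fX fZ g H.w (le_refl (g ⁻¹ᵁ V)) t := by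
    intro t
    induction t using TensorProduct.induction_on with
    | zero => rw [map_zero, map_zero]
    | tmul b s =>
        rw [Algebra.IsPushout.equiv_tmul, bcSections, Algebra.TensorProduct.productMap_apply_tmul]; rfl
    | add x y hx hy => rw [map_add, map_add, hx, hy]
  have : (bcSections fX fZ g H.w (le_refl (g ⁻¹ᵁ V)) : _ → _) = e := funext fun t => (he t).symm
  rw [this]
  exact e.bijective

end One

/-! ## A finite family of affine opens -/

section Pi

variable {J : Type v} (O : J → X.Opens) (Q : J → Z.Opens) (hQ : ∀ j, Q j ≤ g ⁻¹ᵁ (O j))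

/-- Each component of `bcPi` is `bcSections` for `O_j`, `g⁻¹O_j` followed by the restriction to `Q_j`, applied to the
`j`-th tensor component (private plumbing; cf. ★ `SectionsFlatBaseChange`). [folklore] -/
private theorem bcPi_apply_eq_res (hg : g ≫ fX = restrictBase A fZ) (T : B ⊗[A] (∀ j, Sections fX (O j))) (j : J) :
    bcPi fX fZ g hg O Q hQ T j =
      Sections.res (restrictBase A fZ) (hQ j)
        (bcSections fX fZ g hg (le_refl (g ⁻¹ᵁ (O j))) (LinearMap.lTensor B (LinearMap.proj j) T)) := by
  induction T using TensorProduct.induction_on with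
  | zero => simp only [map_zero, Pi.zero_apply]
  | tmul b s =>
      have hres : Sections.res (restrictBase A fZ) (hQ j) (toSectionsBase A fZ (g ⁻¹ᵁ (O j)) b) =
          toSectionsBase A fZ (Q j) b :=
        (Sections.res fZ (hQ j)).commutes b
      rw [LinearMap.lTensor_tmul, LinearMap.proj_apply, bcSections, Algebra.TensorProduct.productMap_apply_tmul,
        map_mul, Sections.res_comap, hres]
      rfl
  | add x y hx hy => simp only [map_add, Pi.add_apply, hx, hy]

/-- Reassembling a tensor in `B ⊗ Π_j M_j` from its components (private linear algebra). [folklore] -/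
private theorem sum_lTensor_single_proj [Fintype J] [DecidableEq J] (T : B ⊗[A] (∀ j, Sections fX (O j))) :
    ∑ j, LinearMap.lTensor B (LinearMap.single A (fun j => Sections fX (O j)) j)
      (LinearMap.lTensor B (LinearMap.proj j) T) = T := by
  induction T using TensorProduct.induction_on with
  | zero => simp only [map_zero, Finset.sum_const_zero]
  | tmul b s =>
      simp only [LinearMap.lTensor_tmul, LinearMap.proj_apply, LinearMap.coe_single]
      rw [← tmul_sum, Finset.univ_sum_single]
  | add x y hx hy => simp only [map_add, Finset.sum_add_distrib, hx, hy]

/-- Components of a reassembled tensor (private linear algebra). [folklore] -/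
private theorem proj_lTensor_single [DecidableEq J] {j j' : J} (t : B ⊗[A] Sections fX (O j)) :
    LinearMap.lTensor B (LinearMap.proj j')
      (LinearMap.lTensor B (LinearMap.single A (fun j => Sections fX (O j)) j) t) =
        if h : j = j' then h ▸ t else 0 := by
  rw [← LinearMap.comp_apply, ← LinearMap.lTensor_comp]
  split_ifs with h
  · subst h
    rw [LinearMap.proj_comp_single_same, LinearMap.lTensor_id, LinearMap.id_apply]
  · rw [LinearMap.proj_comp_single_ne A _ j' j (Ne.symm h), LinearMap.lTensor_zero, LinearMap.zero_apply]

/-- **`B ⊗_A Π_j Γ(X, O_j) → Π_j Γ(Z, g⁻¹O_j)` is bijective for AFFINE `O_j`**, `J` finite, `Q_j = g⁻¹O_j` and ANY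
`A`-algebra `B` (`bcSections_bijective_of_isAffineOpen` componentwise; tensor products commute with finite products —
the proof of ★ `bcPi_bijective`). [cite: GortzWedhorn2020, Prop. 4.20] [cite: StacksProject, Tag 01JO] -/
theorem bcPi_bijective_of_isAffineOpen [Finite J]
    (H : IsPullback g fZ fX (Spec.map (CommRingCat.ofHom (algebraMap A B))))
    (hO : ∀ j, IsAffineOpen (O j)) (hQ' : ∀ j, g ⁻¹ᵁ (O j) ≤ Q j) :
    Function.Bijective (bcPi fX fZ g H.w O Q hQ) := by
  classical
  cases nonempty_fintype J
  have hθ : ∀ j, Function.Bijective (bcSections fX fZ g H.w (le_refl (g ⁻¹ᵁ (O j)))) :=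
    fun j => bcSections_bijective_of_isAffineOpen fX fZ g H (hO j)
  have hρ : ∀ j, Function.Bijective
      (Sections.res (restrictBase A fZ) (V := g ⁻¹ᵁ (O j)) (W := Q j) (hQ j)) := fun j =>
    Function.bijective_iff_has_inverse.mpr
      ⟨Sections.res (restrictBase A fZ) (V := Q j) (W := g ⁻¹ᵁ (O j)) (hQ' j),
        fun s => by rw [Sections.res_res, Sections.res_self],
        fun s => by rw [Sections.res_res, Sections.res_self]⟩
  constructor
  · intro T T' hTT'
    rw [← sub_eq_zero] at hTT' ⊢
    rw [← map_sub] at hTT'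
    set D := T - T'
    have hD : ∀ j, LinearMap.lTensor B (LinearMap.proj j) D = 0 := by
      intro j
      have h := congrFun hTT' j
      rw [bcPi_apply_eq_res, Pi.zero_apply] at h
      exact (hθ j).1 ((((hρ j).1 (h.trans (map_zero _).symm))).trans (map_zero _).symm)
    rw [← sum_lTensor_single_proj fX O D]
    simp only [hD, map_zero, Finset.sum_const_zero]
  · intro F
    choose t ht using fun j => ((hρ j).comp (hθ j)).2 (F j)
    refine ⟨∑ j, LinearMap.lTensor B (LinearMap.single A (fun j => Sections fX (O j)) j) (t j), ?_⟩
    funext j'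
    rw [bcPi_apply_eq_res, map_sum]
    simp only [proj_lTensor_single, Finset.sum_dite_eq', Finset.mem_univ, if_true]
    exact ht j'

end Pi

/-! ## Čech cochains of a finite affine family with affine pairwise intersections -/

section Cochains

variable {ι : Type v} (U : ι → X.Opens)

/-- **`B ⊗_A Č⁰(𝒰, 𝒪_X) → Č⁰(g⁻¹𝒰, 𝒪_Z)` is bijective** for `𝒰` finite with AFFINE members and ANY `A`-algebra `B`.
[cite: GortzWedhorn2020, Prop. 4.20] [cite: StacksProject, Tag 02KH (proof: Čech complex of the base change)] -/
theorem bcC0_bijective_of_isAffineOpen [Finite ι]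
    (H : IsPullback g fZ fX (Spec.map (CommRingCat.ofHom (algebraMap A B))))
    (hU : ∀ i, IsAffineOpen (U i)) : Function.Bijective (bcC0 fX fZ g H.w U) :=
  bcPi_bijective_of_isAffineOpen fX fZ g U (preimageFamily g U) (fun _ => le_rfl) H hU fun _ => le_rfl

/-- **`B ⊗_A Č¹(𝒰, 𝒪_X) → Č¹(g⁻¹𝒰, 𝒪_Z)` is bijective** for `𝒰` finite with AFFINE pairwise intersections
`U_i ∩ U_j` (e.g. affine members of a separated scheme) and ANY `A`-algebra `B`.
[cite: GortzWedhorn2020, Prop. 4.20] [cite: StacksProject, Tag 02KH (proof: Čech complex of the base change)] -/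
theorem bcC1_bijective_of_isAffineOpen [Finite ι]
    (H : IsPullback g fZ fX (Spec.map (CommRingCat.ofHom (algebraMap A B))))
    (hU2 : ∀ i j, IsAffineOpen (U i ⊓ U j)) : Function.Bijective (bcC1 fX fZ g H.w U) := by
  refine (LinearEquiv.bijective (cechPiCurry₂ A (fun i j => Sections (restrictBase A fZ)
      (preimageFamily g U i ⊓ preimageFamily g U j))).symm).comp
    ((bcPi_bijective_of_isAffineOpen fX fZ g (fun p : ι × ι => U p.1 ⊓ U p.2)
      (fun p => preimageFamily g U p.1 ⊓ preimageFamily g U p.2)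
      (fun p _ hx => hx) H (fun p => hU2 p.1 p.2) (fun p _ hx => hx)).comp
    (LinearEquiv.bijective (LinearEquiv.lTensor B
      (cechPiCurry₂ A (fun i j => Sections fX (U i ⊓ U j))))))

end Cochains

end Literature.AlgebraicGeometry.Morphisms

end
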